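import Mathlib
import HarnessLib
import HarnessLib.Audit
import Summits.Parity.Statement
import Literature.NumberTheory.Sieve.PretentiousDistance
import Summits.Parity.GeneralizedHardyLittlewood.Theorems.LeeYangFibresAssemblyClose

/-!
Route: InverseSieveTuples

CLOSED (refuted) 2026-08-15T22:57:47Z by planner-rfix-Parity-InverseSieveTuples-1107b06f-0 — reason: refuted:stmt-Parity-14832 (TupleElliott) by Summit.Parity.GeneralizedHardyLittlewood.Theorems.InverseSieveTuplesTupleElliott_refuted — note: route-repair (planner-rfix seat, 2026-08-15): CLOSED refuted, no honest repair. BROKEN on TupleElliott (stmt-Parity-14832) by Theorems.InverseSieveTuplesTupleElliott_refuted @10a303562d60 [refuted-misstated: shift-divisor blindness, f = 1_{(·,z!)=1}, Ψ = (n, n+z!)]. The offered restatements C′/C″/C‴. The file is kept as the record of this route; refuted decls are indexed as negative knowledge (`ledger negatives`).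

# Route InverseSieveTuples — level-1 ghosts are multiplicative — structure + tuple-EH +
Hardy–Littlewood–Elliott give Dickson by induction on the forms

It suffices to show X = IST ∧ HLE ∧ TEH together with the declared residual R (card
inverse-sieve-theorem, gen 2; the
gen-1 route InverseSieve was retired not-a-thesis because its assembly stopped at fixed-shift
pairs). IST =
InverseSieveUniform, the INVERSE SIEVE THEOREM in finitary-uniform form: at Type-I level x^(1-δ)
with log-power savings
(Bombieri's hypothesis (R), relative to the mass A(x)), a non-negative sequence that is orthogonal
at the top scale to every
1-bounded multiplicative function non-pretentious in the Matomäki–Radziwiłł–Tao sense has the k = 1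
asymptotic
Σ Λ(n)a_n = H·A(x)(1 ± ε) — "the only level-1 ghosts are pretentious-multiplicative". HLE =
TupleElliott, the uniform
Hardy–Littlewood–Elliott conjecture along one-dimensional affine systems (Lichtman–Teräväinen Conj.
1.5 made uniform in f
and in shifts ≤ LN): the randomness half. TEH = TupleLevelOne, relative equidistribution of prime
t-tuples in progressions
to level N^(1-δ) (t = 1 is Elliott–Halberstam): the distribution half. Sieving the LAST form of a
(t+1)-form system with
Bombieri's sieve, whose Type-I data are TEH_t + the t-form count and whose Axiom (M) is HLE, IST
gives the (t+1)-form count: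
induction on t proves Dickson–Hardy–Littlewood in d = 1 with error ε(1 + 𝔖(Ψ))N (SieveStep,
provable); R = RelToAbs
removes the singular-series weight from the error (residual, rates), and the fibration lemma (shared
with DicksonFibration)
lifts d = 1 to the sub-problem Statement.
Lean: `InverseSieveUniform ∧ TupleElliott ∧ TupleLevelOne ∧ RelToAbs`

## Assembly
Pure logic, certified natively (glue.lean): `closes : InverseSieveUniform → TupleElliott →
TupleLevelOne → TupleBrunTitchmarsh →
SieveStep → DimOneRelBase → RelToAbs → FibrationLemma → GeneralizedHardyLittlewood` — feed the four
hypotheses to SieveStep,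
run `Nat.le_induction` from DimOneRelBase to get DimOneRel_t for all t ≥ 1, apply RelToAbs to get
DimOne and FibrationLemma to
get the sub-problem Statement (axioms propext/Classical.choice/Quot.sound; Sketch.lean rc 0). All
mathematics sits in the items:
three open cruxes (structure, randomness, distribution), one provable XL step, two provable
supports, one shared provable bridge,
one declared residual.

Rationale: WHY THIS LINE. Bombieri's asymptotic sieve (BombieriAsymptoticSieve1976;
Friedlander2006ProducingPrimes pp. 19–21; FriedlanderIwaniecPisa1978)
determines Σ a_nΛ_k for k ≥ 2 from level-1 Type-I data and leaves k = 1 free up to α ∈ [0,2]; every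
known α ≠ 1 sequence
(Selberg1952Limitations, Ford2004, FordMaynard2024PrimeSieves §6, the Siegel model of
TaoTeravainen2022SiegelZero) is a
pretentious-multiplicative twist, and even Ford–Maynard's g(Ω(n))-ghosts are averages of the
multiplicative z^Ω(n). The route
imports the structure-vs-randomness paradigm of additive combinatorics (inverse theorems,
GreenTao2010/GreenTaoZiegler2012) and
pretentious multiplicative number theory (GranvilleSoundararajan2008, MatomakiRadziwillTao2015,
LichtmanTeravainen2022 Thm 1.6)
into sieve axiomatics, and — new in gen 2 — runs the sieve as an INDUCTION ON THE NUMBER OF FORMS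
whose Type-I input is the
RELATIVE tuple Elliott–Halberstam statement (no main terms, hence non-circular: the main terms come
from the induction
hypothesis), so that the conclusion is the full one-dimensional Green–Tao conjecture and, via the
fibration lemma, GHL itself.
What it does that the negatives index / prior routes do not: MobiusShiftedPrimes, KataiPropagation,
InverseSieve (all retired)
reached fixed-shift pairs only; here shifts ≤ LN, general slopes and all t are inside the cruxes,
and the planning located the
exact obstruction to absolute uniformity — the step t → t+1 multiplies errors by H = 𝔖(Ψ)/𝔖(Ψ_≤t) ≍
log log N on primorial
shifts — isolating it as the thin residual RelToAbs with a documented discharge by rate versions of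
IST/HLE.

RANKED CRUXES. #0 DimOne (target) — the d = 1 case of Green–Tao Conj. 1.2 (Dickson–Hardy–Littlewood
with von Mangoldt weights) for every t ≥ 1, uniform over non-degenerate systems a_i n + b_i with
‖Ψ‖_N ≤ L and convex K ⊆ [−N, N] — VERBATIM the shared item stmt-Parity-0819
(DicksonFibration.DimOne); reached here as RelToAbs (SieveStep-induction, DimOneRelBase). (why it
might fail: = shift-uniform Dickson/HL (twins, Sophie Germain, Goldbach in the shift);
Siegel-sensitive as typed (MatomakiMerikoski2023 Thm 1.3); parity blocks every pure sieve
derivation; GTZ is vacuous at d = 1.) [GreenTao2010, MatomakiMerikoski2023, HardyLittlewood1923,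
Dickson1904]
#2 InverseSieveUniform (crux) — INVERSE SIEVE THEOREM, finitary and uniform (card Crux 1, gen-2
form). For every density-class constant M and ε > 0 there are δ, η > 0, and for every exemption
level A₀ ≥ 1 and regularity constant M' there are B, x₀, such that for x ≥ x₀: if a ≥ 0 on [1, x]
has a multiplicative density g in the dimension-one class (0 ≤ g(p^k) ≤ M/p^k, g(p) ≤ 1 − 1/M, and
at each prime either g(p) = 0 or |g(p) − 1/p| ≤ M/p²), mass regularity A(y) ≤ M'(y/x)A(x) + ηA(x),
the crude bound A_d(y) ≤ M'(A(x)/d + 1)(log x)^M' for all d < x (Bombieri's (A₃)), Type-I data Σ_(d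
≤ x^(1−δ)) sup_y |A_d(y) − g(d)A(y)| ≤ A(x)(log x)^(−B) (hypothesis (R) at level x^(1−δ)), and AXIOM
(M): |Σ_(n≤x) a_n f(n)| ≤ ηA(x) for every 1-bounded multiplicative f with 𝔻(f, χn^(iτ); x)² ≥ A₀ for
all q ≤ A₀, χ mod q, |τ| ≤ x² — then |Σ_(n≤x) Λ(n)a_n − H_g(x)A(x)| ≤ ε·H_g(x)·A(x), H_g(x) =
Π_(p≤x)(1 − g(p))/(1 − 1/p). Contrapositive: a level-1 sequence whose prime mass deviates
correlates, at relative density η, with a uniformly non-pretentious multiplicative function.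
[difficulty: open-problem] (why it might fail: primes sit in the cell {Ω_>y(n)=1}, y=x^ε, of mass
1.78εx<ηA(x): b=λ(n)W(smooth part) there passes (M) by mass alone and kills all primes; W≡1 is
Type-I visible only at (log x)^−2 (Σλ(s)log s/s=−ζ(2)); if dilated log-moments of W can be tuned to
any order B, IST is false.) [BombieriAsymptoticSieve1976, Friedlander2006ProducingPrimes,
FriedlanderIwaniecPisa1978, Ford2004, FordMaynard2024PrimeSieves, MatomakiRadziwillTao2015,
Selberg1952Limitations, GranvilleSoundararajan2008]
#3 TupleElliott (crux) — UNIFORM HARDY–LITTLEWOOD–ELLIOTT along one-dimensional affine systems (card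
Crux 2 generalised; Lichtman–Teräväinen Conj. 1.5 with one multiplicative slot, made uniform in f as
in Matomäki–Radziwiłł–Tao and in the system): for t ≥ 1, L and η > 0 there are A₀, N₀ such that for
N ≥ N₀, every non-degenerate system Ψ = (ψ_0, …, ψ_t) of t+1 forms on ℤ with ‖Ψ‖_N ≤ L, every
interval [u, v] ⊆ [−N, N] and every 1-bounded multiplicative f with 𝔻(f, χn^(iτ); N)² ≥ A₀ for all q
≤ A₀, χ mod q, |τ| ≤ N: |Σ_(u≤n≤v, ψ_t(n)>0) Λ(ψ_0(n))⋯Λ(ψ_(t−1)(n))·f(ψ_t(n))| ≤ η·(N + Σ_(u≤n≤v)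
Λ(ψ_0(n))⋯Λ(ψ_(t−1)(n))) — cancellation RELATIVE to the tuple mass (which is ≍ 𝔖(Ψ_<t)N, up to N log
log N on primorial shifts; an absolute ηN would be false via f = λ_y). t = 1 contains Σ_p μ(p+h) =
o(π(x)), Kátai–Hildebrand mean values f(p+h), the Goldbach shape f(M − p) and Sophie Germain
f(2p+1), uniformly in |h|, M ≤ LN. [difficulty: open-problem] (why it might fail: contains
μ(p+h)=o(π) (open) and LT Conj 1.5; shift-uniformity |b_i| ≤ LN makes it Landau–Siegel-hard (an
exceptional χ mod q ∈ (A₀, LN] lets f = λ mimic χ on p+q, bias ≍ N); an f tuned to the sifted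
support {m ≢ b_i (p)} of shifted prime tuples might correlate at fixed A₀.) [LichtmanTeravainen2022,
MatomakiRadziwillTao2015, Hildebrand1989, MurtyVatwani2017, TaoTeravainen2022SiegelZero, Tao2016,
Elliott1994, Katai1986]
#4 TupleLevelOne (crux) — RELATIVE TUPLE ELLIOTT–HALBERSTAM (distribution half; no main term, hence
it asserts nothing about existence): for t ≥ 1, L, δ > 0 and every B there is C with, for all N ≥ 2,
every non-degenerate system Ψ of t forms on ℤ with ‖Ψ‖_N ≤ L, and every choice of intervals [u_d,
v_d] ⊆ [−N, N] and residues r_d: Σ_(d ≤ N^(1−δ)) |Σ_(n∈[u_d,v_d], n≡r_d (d)) Π_iΛ(ψ_i(n)) − w_Ψ(d,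
r_d)·Σ_(n∈[u_d,v_d]) Π_iΛ(ψ_i(n))| ≤ C N (log N)^(−B), where w_Ψ(d, r) = 1/#(admissible classes mod
d) if r is admissible (gcd(ψ_i(r), d) = 1 for all i) and 0 otherwise. t = 1 is the (relative,
interval) Elliott–Halberstam conjecture; t ≥ 2 says prime t-tuples are equidistributed among
admissible classes to level N^(1−δ) (the restricted system's β_p is class-independent, so this is
the right model). [difficulty: open-problem] (why it might fail: t=1 is EH; t≥2 is
square-root-heuristic equidistribution of prime tuples to moduli N^(1−δ), known only at level 1/2 on
average over shifts (Mikawa); Maier/Friedlander–Granville irregularities kill level N(log N)^(−B) —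
we stay at N^(1−δ); a sup over ALL residues r (not only admissible) is included.)
[ElliottHalberstam1970, doi:10.21099/tkbjm/1496161970, FriedlanderGranville1989,
BombieriFriedlanderIwaniecActa1986, Polymath8b2014, Maynard2015SmallGaps]
#9 TupleBrunTitchmarsh (support) — upper-bound sieve for prime t-tuples on intervals (Selberg
Λ²/Brun–Titchmarsh shape, uniform in the system): for t, L, δ > 0 there are C, N₀ with Σ_(u≤n≤v)
Π_iΛ(ψ_i(n)) ≤ C(1 + 𝔖(Ψ))(v − u) + N^δ for all N ≥ N₀, non-degenerate Ψ of t forms with ‖Ψ‖_N ≤ L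
and [u, v] ⊆ [−N, N]; the factor 1 + 𝔖(Ψ) is necessary (primorial shifts). Provable from the tree's
Selberg-sieve framework (SieveFrameworkProofs, Shiu1980BrunTitchmarsh_holds pattern). [difficulty:
L] [Shiu1980, HalberstamRichert1974, Friedlander1989BrunTitchmarsh, GreenTao2010]
#9 SieveStep (support) — THE INDUCTIVE STEP (provable bookkeeping, the vector form of Bombieri's
sieve): IST → HLE → TEH → TupleBrunTitchmarsh → for every t ≥ 1, DimOneRel_t → DimOneRel_(t+1),
where DimOneRel_t is DimOne at t with error ε(1 + 𝔖(Ψ))N. Proof plan: given a (t+1)-system Ψ and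
convex K, sift the last form: c_m = Σ_(n∈K⁺, ψ_t(n)=m) Π_(i<t)Λ(ψ_i(n)) on m ≤ x ≍ N (K⁺ = K ∩ (ψ_t
> 0)); cases |K⁺| ≤ νN (TupleBrunTitchmarsh) and 𝔖(Ψ_<t) = 0 or g(p) = 1 (local obstruction, O(log^C
N)) are direct; otherwise C(x) ≥ cνN, the density g(d) = Σ_(roots ρ of ψ_t mod d) w_(Ψ_<t)(d, ρ) is
multiplicative (CRT) and in the class with M = (2t+L+2)², Type-I for c relative to C(x) follows from
TEH_t (≤ L classes per modulus) plus the induction hypothesis on sub-intervals, mass/crude bounds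
are trivial, Axiom (M) for c at (A₀+1, x) is HLE at (A₀, N) (𝔻(·;N)² ≥ 𝔻(·;x)² − 1, |τ| ≤ N ≤ x²),
IST gives Σ_m Λ(m)c_m = H_g(x)C(x)(1 ± ε'), and β_p(Ψ) = β_p(Ψ_<t)·(p/(p−1))(1 − g(p)), archFactor Ψ
K = archFactor Ψ_<t K⁺, GT Lemma 1.3 (tree: tendsto_singularProductPartial_holds) turn
H_g(x)·β_∞𝔖(Ψ_<t) into β_∞𝔖(Ψ) + o((1+𝔖(Ψ))N); the IH error ε_t(1+𝔖_<t)N times H_g ≤ 𝔖(Ψ)/c_t stays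
relative. [difficulty: XL] [BombieriAsymptoticSieve1976, FriedlanderIwaniecPisa1978,
Friedlander2006ProducingPrimes, GreenTao2010, Gallagher1976]
#9 DimOneRelBase (support) — the base t = 1 of the induction (= DimOne at t = 1, relative form):
Σ_(n∈K) Λ(an + b) = |K ∩ (an+b > 0)|·(|a|/φ(|a|))·1[(a,b)=1] + o(N) uniformly for |a| ≤ L, |b| ≤ LN,
intervals K ⊆ [−N, N] — PNT in progressions to the fixed moduli ≤ L over intervals of length ≤ 2LN
(tree, proved: Literature.NumberTheory.Sieve.siegel_walfisz via siegel_walfisz_holds), plus the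
evaluation of singularProduct/archFactor for one form. [difficulty: M] [Walfisz1936, GreenTao2010,
HardyLittlewood1923]
#9 RelToAbs (support) — RESIDUAL (declared; GHL-hard but thin): Dickson in d = 1 with error ε(1 +
𝔖(Ψ))N for every t implies DimOne (error εN). Content = uniformity over systems whose singular
series exceeds every bound (shifts with many small prime factors, 𝔖 ≍ (log log N)^O(t)); it is
exactly what fixed-η structure + randomness cannot give, because the step t → t+1 multiplies errors
by H = 𝔖(Ψ)/𝔖(Ψ_<t). Discharge routes (not filed): rate versions — IST with error C(η^c + e^(−cA₀) +
δ^c + (log x)^(−c))·H_g·A for A₀ ≤ c log log x, HLE with the Lichtman–Teräväinen exponential rate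
e^(−cM(f)) (their Thm 1.6 shape), TEH at level N·exp(−(log N)^(1/2)) — give DimOne with a log-power
saving directly. [difficulty: open-problem] [GreenTao2010, MatomakiMerikoski2023,
LichtmanTeravainen2022, Gallagher1976, MatomakiRadziwillTao2015]
#9 FibrationLemma (support) — the fibration lemma DimOne → GeneralizedHardyLittlewood (VERBATIM the
shared item stmt-Parity-0822 = DicksonFibration.Assembly: shear, convex fibres, Gallagher/CRT
averaging of fibre singular products uniform in shifts ≤ CLN; provable, XL). [difficulty: XL]
[GreenTao2010, Gallagher1976]

TWO-LAYER PLAN. Foreseen glued splits (k ≤ 3, depth 1), filed only when a crux closes or stalls with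
a census: SieveStep ⇐ WeightedFormTypeI
(TEH_t + IH ⇒ Bombieri data of c, CRT density in the class) → LastFormSieve (apply IST + HLE) →
MainTermIdentity (β_p factorisation,
archFactor fibre identity, tails) → SieveStep; InverseSieveUniform ⇐ CellRigidity (Type-I rigidity
of the large-prime cell: no bounded weight W on
{Ω_>y(n) = 1} has all dilated logarithmic moments vanishing beyond a fixed order B₀ — the lemma that
defeats the cheapest
falsifier; prime-free, attackable now) → LevelOneResidual (Σ Λa = H A + R₁ + small, R₁ = correlation
of a with μ restricted to
the sieve-structured set — the gen-1 support, restated over Mathlib) → MultiplicativeGhostsLemma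
(IST for a = 1 + b, b real
multiplicative; the refuter's caution on the gen-1 sketch applies) → InverseSieveUniform;
TupleElliott ⇐ fixed-f Kátai–Hildebrand along affine pairs → MRT
uniformity upgrade (pretentious large sieve over shifted primes) → TupleElliott; RelToAbs ⇐ the
three rate statements of its
block → RelToAbs (turning the residual into cruxes of a successor route if this one earns tenure).

KILL CRITERIA. A Theorems file proving ¬InverseSieveUniform by an explicit level-1 Type-I-regular,
multiplicatively orthogonal sequence with
biased prime mass closes the route `refuted:InverseSieveUniform` — and is itself the first
non-multiplicative parity ghost (hand it
to the barrier catalogue next to FordFixedLevelBarrier / SignGhost). ¬InverseSieveUniform by a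
NORMALISATION witness (e.g. a
sequence of mass o(x) on rough numbers, or a density g outside the stated class) is
`refuted-misstated`: repair the class, keep
the line. ¬TupleElliott at t = 1 by a λ-like f refutes shift-uniform HL pairs' randomness input —
pivot to the fixed-shift
sub-family (drop |b_i| ≤ LN, route then ends at fixed-shift tuples + a Landau–Siegel residual); by
an exotic f (support-adapted)
⇒ restate HLE for the class of f that an IST proof outputs. ¬TupleLevelOne for t ≥ 2 (tuples
irregular at level N^(1−δ)) ⇒ pivot
to level 1 − o(1) variants or close. DimOne proved by any sibling (HyperbolicConstellations,
PrimeDeterminantCells) moots the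
Assembly but not IST, which keeps stand-alone value as a Literature-level structure conjecture.

NOT DECOMPOSED YET. The rate versions (IST polynomial in η with the e^(−cA₀)/δ^c terms, HLE
exponential in A₀ for A₀ ≤ c log log N, TEH at level
N^(1−o(1))) that would discharge RelToAbs — deliberately not cruxes at open (second-order bets on
top of open conjectures);
Bombieri's general density class (A₅) (ζ(s+1)b(s), e.g. g(p) = (1+χ(p))/p) — IST is filed for the
prime-by-prime class only,
which is all SieveStep needs; the exact class of f an IST proof outputs (would let HLE shrink to
real-valued or λ·pretentious
f); the k-slot Hardy–Littlewood–Elliott (several multiplicative slots) — unnecessary here; constants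
C(t, L, δ) of
TupleBrunTitchmarsh; the d ≥ 2 fibration (FibrationLemma, owned by DicksonFibration's planned
three-way split).

CHEAPEST FALSIFIER. For IST (decisive; PLANNING_ANALYSIS.md §5, attached as evidence): the
LARGE-PRIME CELL GHOST a = 1 + λ(n)W(s_y(n))·1[Ω_(>y)(n)=1], y = x^ε,
ε < η/4, W(1) = 1 — g(d) = 1/d, passes Mass/Crude and Axiom (M) by mass alone (cell mass 1.78εx),
prime mass ψ(y): it refutes the crux
iff W can be tuned Type-I invisible to the order B the statement picks. W ≡ 1 is visible at (log
x)^(−2) (Σλ(s)log s/s = −ζ(2));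
Ω-dependent, log-size-dependent, character and archimedean W do no better (checked by hand).
Refuter: decide whether a bounded W in
several arithmetic coordinates of s makes all dilated moments M_j(d) = Σ_(s'≤T) λ(s')W(ds')(log
s')^j/s' vanish to order B+2 for
all smooth d ≤ x^(1−δ) (⇒ ¬InverseSieveUniform and every fixed-precision Axiom-(M) form of the card
dies), or prove the cell Type-I
rigid beyond a fixed order B₀ (crux survives with B > B₀). First probe: kit least-squares for W on
smooth s ≤ 10⁴, d ≤ 300. For HLE: literature
lookup whether LT Conj. 1.5 is stated anywhere uniformly in the shift (Siegel caveat) — none found.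
For TEH: Mikawa-type BV
for twins at level 1/2 is consistent; a Maier-matrix computation at level N(log N)^(−B) is
irrelevant by design.

NUMBERS. Bombieri: α ∈ [0, 2] at level x^(1−ε) ∀ε, k ≥ 2 determined, k = 1 free
(Friedlander2006ProducingPrimes pp. 20–21; tree:
bombieri_asymptotic_sieve_indeterminacy, Bombieri1976_asymptotic_sieve_holds); fixed level ϑ < 1
fails even for k ≥ 2 (Ford2004).
λ is tested by Axiom (M): M(λ; X, (log X)^A) ≥ (1/3 − ε) log log X + O(1) (LichtmanTeravainen2022
Remark 1.7, Vinogradov–Korobov).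
LT Thm 1.6: HL–Elliott on average over h₁ ≤ H, (log X)^(ℓ+ε) ≤ H ≤ exp((log X)^(1/1000)), saving
exp(−M(f₁; X, ·)/(10⁴ℓ/ε)) +
(log log H)/log H — the exponential-in-M rate that the RelToAbs discharge needs. HLE sharpness: f =
Liouville of the y-smooth part,
𝔻² ≈ log log y = A₀, correlation with shifted primes ≈ Π_(p≤y)(1 − 2/(p−1))·N ≍ e^(−2A₀)N, so η(A₀)
cannot decay faster than
e^(−2A₀). Amplification: H = 𝔖(Ψ)/𝔖(Ψ_<t) ≤ C_t·Π_(p | a_tΠD_it)(1 − 1/p)^(−1) ≍ log log N on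
primorial shifts ≤ LN, while A₀ ≤
2 log log N always (𝔻² ≤ Σ_(p≤N) 2/p) — the quantitative reason RelToAbs is a separate item. Items
at open: 10 (1 target, 3
cruxes, 5 support, 1 assembly).

DEFINITION REQUESTS. None. AffLinForm, IsNondegenerateSystem, affLinSize, vonMangoldtSum,
archFactor, singularProduct, realBox, intVonMangoldt
(Literature.NumberTheory.Sieve, LinearEquationsInPrimes) and pretentiousDistSq, twistedChar
(PretentiousDistance; all its named facts
have _holds) exist; the Bombieri data of a finite sequence are spelled inline over Mathlib (no
import of BombieriAsymptoticSieve*,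
whose modules carry unproved named facts — cone guardrail). A Literature-level
`HardyLittlewoodElliottConjecture` (LT Conj. 1.5) and a
finitary `IsLevelOneSequence` predicate would shorten TupleElliott / InverseSieveUniform; file only
if a second route wants them.

Novelty: Searches (2026-08-15): `lit frontier Parity --since 2020` (30 rows: BanksFord2026 arXiv:2605.01155
random Bateman–Horn sets, arXiv:2405.12190, "On variants of Chowla's conjecture"
doi:10.1090/proc/17544 — none an inverse sieve theorem); `lit bridges Parity --cross any` (30,
monographs); `lit search --source crossref "correlations multiplicative functions shifted primes
Hardy Littlewood tuples Elliott"` (19: Hildebrand1989, Sachpazis 2022 doi:10.1016/j.jnt.2021.06.027,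
Elliott, Indlekofer–Timofeev, Stepanauskas — mean values on shifted primes, no HL coupling); `lit
search --source crossref "prime k-tuples arithmetic progressions large moduli Bombieri-Vinogradov
type theorem"` (19: BFI I–III, Baier–Pujahari, Tolev 1997 — no tuple-EH); `lit search --source
crossref "prime twins in arithmetic progressions Mikawa"` (Mikawa 1992
doi:10.21099/tkbjm/1496161970, Tolev 1999); `lit galaxy search "Bombieri's asymptotic sieve" --star
all` (12: Ramaré Excursions, Greaves, Harman, FHIK Cetraro, Diamond–Halberstam–Richert 1988, BFI
Acta 1986); `lit galaxy search "parity problem" --star pdf` (noise + Granville's survey); `lit read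
arxiv:2111.08912` pp. 3–4 (LT Conj. 1.1 HL–Chowla, Conj. 1.5 HL–Elliott, Thm 1.6 with the e^(−M)
rate); `lit read book:friedlandernd-analytic-number-theory --grep` pp. 19–21 (Friedlander's Cetraro
notes: hypothesis (R) relative to A(x), H, α ∈ [0,2], Ford optimality); local searchd hybrid leg,
OpenAlex, S2, arXiv, zbMATH legs unavailable/429 today (recorded; the gen  [refs: 10.1090/proc/17544, 10.1016/j.jnt.2021.06.027, 10.21099/tkbjm/1496161970, 10.1017/fms.2022.54, 2605.01155, 2405.12190, 2111.08912, doi:10.1090/proc/17544, doi:10.1016/j.jnt.2021.06.027, doi:10.21099/tkbjm/1496161970, arxiv:2111.08912, book:friedlandernd-analytic-number-theory, doi:10.1017/fms.2022.54, BanksFord2026, Hildebrand1989, LichtmanTeravainen2022, BombieriAsymptoticSieve1976, Ford2004, Ell]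

Barriers (technique_class: inverse-sieve-theorem, pretentious, induction-on-forms): - technique_class: inverse-sieve-theorem, pretentious, induction-on-forms
- Literature.Barriers.Parity.SelbergParityBarrier: not contested — IST conjectures the STRUCTURE of
the indeterminacy the barrier establishes; Selberg's 1 ± λ satisfy IST's conclusion (f = λ is
tested: M(λ; x, A₀) → ∞ for fixed A₀); the prime detection uses the non-sieve axiom HLE, as the
barrier demands.
- Literature.Barriers.Parity.FordFixedLevelBarrier: evaded by hypothesis — InverseSieveUniform
chooses δ(ε, M) (level x^(1−δ), δ → 0 as ε → 0), exactly Bombieri's regime; Ford's fixed-level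
ghosts are multiplicative and would be caught by Axiom (M) anyway, but the item does not bet on
fixed level.
- Literature.Barriers.Parity.FordMaynardMinimalTypeII: the route feeds NO Type-II information; its
substitute is Axiom (M)/HLE at the top scale, outside the Type-I/II sieve class the barrier
measures; Ford–Maynard's extremal sequences (§6, modified Liouville functions g(Ω)) are averages of
multiplicative z^Ω and fail Axiom (M) — consistent with IST.
- Literature.Barriers.Parity.MatomakiRadziwillTao2015_counterexample: respected by construction —
non-pretentiousness is the corrected, locally-uniform-in-τ form (|τ| ≤ N in HLE, |τ| ≤ x² in IST's
Axiom (M), all q ≤ A₀), never Elliott's original pointwise form (ElliottConjectureOriginal).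
- Literature.Barriers.Parity.PrimePairParity: the assembly is not weight-insertion invariant —
inserting the sign ghosts of SignGhost.lean (polynomials in λ(ψ_i(n)), i.e. multipl

History (route lifecycle, newest last):
- 2026-08-15T22:35:24Z · BROKEN — TupleElliott (stmt-Parity-14832, crux) refuted by Summit.Parity.GeneralizedHardyLittlewood.Theorems.InverseSieveTuplesTupleElliott_refuted @ 10a303562d60 (refuter-cdisprove-stmt-Parity-14832-0)
- 2026-08-15T22:57:48Z · CLOSED refuted — refuted:stmt-Parity-14832 (TupleElliott) by Summit.Parity.GeneralizedHardyLittlewood.Theorems.InverseSieveTuplesTupleElliott_refuted (planner-rfix-Parity-InverseSieveTuples-1107b06f-0)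

sub-problem: GeneralizedHardyLittlewood · status: closed(refuted) · opened planner-plancard-Parity-GeneralizedHardyLittl-fe6c7a49-g2-0 2026-08-15T19:12:59Z · rev 4 · ledger route-Parity-InverseSieveTuples
GENERATED by the gate from the ledger (D-0016/17). Provers cite these decls: `theorem foo : Summit.Parity.GeneralizedHardyLittlewood.Theses.InverseSieveTuples.<Decl> := …` in Summits/Parity/GeneralizedHardyLittlewood/Theorems/<Name>.lean.
-/

namespace Summit.Parity.GeneralizedHardyLittlewood.Theses.InverseSieveTuples

open scoped BigOperators Topology Manifold Classical MeasureTheory ProbabilityTheory Matrix InnerProductSpace ComplexConjugate ContinuousMap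
open Filter Set Function TopologicalSpace MeasureTheory

attribute [summit_statement] _root_.GeneralizedHardyLittlewood

/-- item stmt-Parity-0819 · target · rank 0 · open · by planner
why it might fail: = shift-uniform Dickson/HL (twins, Sophie Germain, Goldbach in the shift); Siegel-sensitive as typed (MatomakiMerikoski2023 Thm 1.3); parity blocks every pure sieve derivation; GTZ is vacuous at d = 1.
sources: GreenTao2010, MatomakiMerikoski2023, HardyLittlewood1923, Dickson1904
[crux] The d = 1 case of Literature.NumberTheory.Sieve.GeneralizedHardyLittlewood
(Dickson–Hardy–Littlewood, Λ-weighted): for all t ≥ 1, L, uniformly over non-degenerate systems of t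
forms a_i n + b_i with ‖Ψ‖_N ≤ L (so |b_i| ≤ L N) and intervals K ⊆ [-N, N]: |∑_{n ∈ K} ∏ Λ(a_i n +
b_i) − β_∞ ∏_p β_p| ≤ ε N for N ≥ N₀(t, L, ε). Open (contains twin primes, Sophie Germain, Goldbach
asymptotics uniformly in the shift). GHL → DimOne is immediate; the route's content is the converse
(Assembly). [GreenTao2010, Conj. 1.2, p. 6] -/
@[route_item "route-Parity-InverseSieveTuples"]
def DimOne : Prop :=
  ∀ (t L : ℕ), 1 ≤ t → ∀ ε : ℝ, 0 < ε → ∃ N₀ : ℕ, ∀ N : ℕ, N₀ ≤ N → ∀ Ψ : Fin t → Literature.NumberTheory.Sieve.AffLinForm 1, Literature.NumberTheory.Sieve.IsNondegenerateSystem Ψ → Literature.NumberTheory.Sieve.affLinSize Ψ N ≤ L → ∀ K : Set (Fin 1 → ℝ), Convex ℝ K → K ⊆ Literature.NumberTheory.Sieve.realBox 1 N → |Literature.NumberTheory.Sieve.vonMangoldtSum Ψ K N - Literature.NumberTheory.Sieve.archFactor Ψ K * Literature.NumberTheory.Sieve.singularProduct Ψ| ≤ ε * (N : ℝ)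

/-- item stmt-Parity-14831 · crux · rank 2 · closed · moot by None · by planner
why it might fail: primes sit in the cell {Ω_>y(n)=1}, y=x^ε, of mass 1.78εx<ηA(x): b=λ(n)W(s) there passes (M) by mass and kills all primes; it refutes the crux iff W can be tuned Type-I invisible to the order B chosen — W≡1 is visible at (log x)^−2, and every structured W tried hits an order-≤1 Euler-product wall.
sources: BombieriAsymptoticSieve1976, Friedlander2006ProducingPrimes, FriedlanderIwaniecPisa1978, Ford2004, FordMaynard2024PrimeSieves, MatomakiRadziwillTao2015
[crux] INVERSE SIEVE THEOREM, finitary and uniform (card Crux 1, gen-2 form). For every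
density-class constant M and ε > 0 there are δ, η > 0, and for every exemption level A₀ ≥ 1 and
regularity constant M' there are B, x₀, such that for x ≥ x₀: if a ≥ 0 on [1, x] has a
multiplicative density g in the dimension-one class (0 ≤ g(p^k) ≤ M/p^k, g(p) ≤ 1 − 1/M, and at each
prime either g(p) = 0 or |g(p) − 1/p| ≤ M/p²), mass regularity A(y) ≤ M'(y/x)A(x) + ηA(x), the crude
bound A_d(y) ≤ M'(A(x)/d + 1)(log x)^M' for all d < x (Bombieri's (A₃)), Type-I data Σ_(d ≤ x^(1−δ))
sup_y |A_d(y) − g(d)A(y)| ≤ A(x)(log x)^(−B) (hypothesis (R) at level x^(1−δ)), and AXIOM (M):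
|Σ_(n≤x) a_n f(n)| ≤ ηA(x) for every 1-bounded multiplicative f with 𝔻(f, χn^(iτ); x)² ≥ A₀ for all
q ≤ A₀, χ mod q, |τ| ≤ x² — then |Σ_(n≤x) Λ(n)a_n − H_g(x)A(x)| ≤ ε·H_g(x)·A(x), H_g(x) = Π_(p≤x)(1
− g(p))/(1 − 1/p). Contrapositive: a level-1 sequence whose prime mass deviates correlates, at
relative density η, with a uniformly non-pretentious multiplicative function. [difficulty:
open-problem] -/
@[route_item "route-Parity-InverseSieveTuples"]
def InverseSieveUniform : Prop :=
  ∀ M : ℝ, 1 ≤ M → ∀ ε : ℝ, 0 < ε → ∃ δ η : ℝ, 0 < δ ∧ 0 < η ∧ ∀ A₀ M' : ℝ, 1 ≤ A₀ → 1 ≤ M' → ∃ B x₀ : ℝ, ∀ x : ℝ, x₀ ≤ x → ∀ (a : ℕ → ℝ) (g : ArithmeticFunction ℝ), g.IsMultiplicative → (∀ n, 0 ≤ a n) → (∀ p k : ℕ, p.Prime → 1 ≤ k → 0 ≤ g (p ^ k) ∧ g (p ^ k) ≤ M / (p : ℝ) ^ k) → (∀ p : ℕ, p.Prime → g p ≤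 1 - 1 / M ∧ (g p = 0 ∨ |g p - (p : ℝ)⁻¹| ≤ M / (p : ℝ) ^ 2)) → (let A : ℝ → ℝ := fun y => ∑ n ∈ Finset.Icc 1 ⌊y⌋₊, a n; let Ad : ℕ → ℝ → ℝ := fun d y => ∑ n ∈ (Finset.Icc 1 ⌊y⌋₊).filter (fun n => d ∣ n), a n; let H : ℝ := ∏ p ∈ Nat.primesLE ⌊x⌋₊, (1 - g p) / (1 - (p : ℝ)⁻¹); (∀ y : ℝ, 1 ≤ y → y ≤ x → A y ≤ M' * (y / x) * A x + η * A x) → (∀ (d : ℕ) (y : ℝ), 1 ≤ d → (d : ℝ) < x → 0 ≤ y → y ≤ x → Ad d y ≤ M' * (A x / d + 1) * Real.log x ^ M') → (∀ y : ℕ → ℝ, (∀ d, 0 ≤ y d ∧ y d ≤ x) → ∑ d ∈ Finset.Icc 1 ⌊x ^ (1 - δ)⌋₊, |Ad d (y d) - g d * A (y d)| ≤ A x / Real.log x ^ B) → (∀ f : ArithmeticFunction ℂ, f.IsMultiplicative → (∀ n, ‖f n‖ ≤ 1) → (∀ (q : ℕ) (χ : DirichletCharacter ℂ q) (τ : ℝ),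 1 ≤ q → (q : ℝ) ≤ A₀ → |τ| ≤ x ^ 2 → A₀ ≤ Literature.NumberTheory.Sieve.pretentiousDistSq (⇑f) (Literature.NumberTheory.Sieve.twistedChar χ τ) x) → ‖∑ n ∈ Finset.Icc 1 ⌊x⌋₊, ((a n : ℝ) : ℂ) * f n‖ ≤ η * A x) → |(∑ n ∈ Finset.Icc 1 ⌊x⌋₊, ArithmeticFunction.vonMangoldt n * a n) - H * A x| ≤ ε * H * A x)

/-- item stmt-Parity-14832 · crux · rank 3 · closed · refuted by Summit.Parity.GeneralizedHardyLittlewood.Theorems.InverseSieveTuplesTupleElliott_refuted @ 10a303562d60 (refuter) · by planner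
why it might fail: contains μ(p+h)=o(π) (open) and LT Conj 1.5; shift-uniformity |b_i| ≤ LN makes it Landau–Siegel-hard (an exceptional χ mod q ∈ (A₀, LN] lets f = λ mimic χ on p+q, bias ≍ N); an f tuned to the sifted support {m ≢ b_i (p)} of shifted prime tuples might correlate at fixed A₀.
sources: LichtmanTeravainen2022, MatomakiRadziwillTao2015, Hildebrand1989, MurtyVatwani2017, TaoTeravainen2022SiegelZero, Tao2016
[crux] UNIFORM HARDY–LITTLEWOOD–ELLIOTT along one-dimensional affine systems (card Crux 2
generalised; Lichtman–Teräväinen Conj. 1.5 with one multiplicative slot, made uniform in f as in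
Matomäki–Radziwiłł–Tao and in the system): for t ≥ 1, L and η > 0 there are A₀, N₀ such that for N ≥
N₀, every non-degenerate system Ψ = (ψ_0, …, ψ_t) of t+1 forms on ℤ with ‖Ψ‖_N ≤ L, every interval
[u, v] ⊆ [−N, N] and every 1-bounded multiplicative f with 𝔻(f, χn^(iτ); N)² ≥ A₀ for all q ≤ A₀, χ
mod q, |τ| ≤ N: |Σ_(u≤n≤v, ψ_t(n)>0) Λ(ψ_0(n))⋯Λ(ψ_(t−1)(n))·f(ψ_t(n))| ≤ η·(N + Σ_(u≤n≤v)
Λ(ψ_0(n))⋯Λ(ψ_(t−1)(n))) — cancellation RELATIVE to the tuple mass (which is ≍ 𝔖(Ψ_<t)N, up to N log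
log N on primorial shifts; an absolute ηN would be false via f = λ_y). t = 1 contains Σ_p μ(p+h) =
o(π(x)), Kátai–Hildebrand mean values f(p+h), the Goldbach shape f(M − p) and Sophie Germain
f(2p+1), uniformly in |h|, M ≤ LN. [difficulty: open-problem] -/
@[route_item "route-Parity-InverseSieveTuples"]
def TupleElliott : Prop :=
  ∀ (t L : ℕ), 1 ≤ t → ∀ η : ℝ, 0 < η → ∃ A₀ : ℝ, ∃ N₀ : ℕ, ∀ N : ℕ, N₀ ≤ N → ∀ Ψ : Fin (t + 1) → Literature.NumberTheory.Sieve.AffLinForm 1, Literature.NumberTheory.Sieve.IsNondegenerateSystem Ψ → Literature.NumberTheory.Sieve.affLinSize Ψ N ≤ L → ∀ u v : ℤ, -(N : ℤ) ≤ u → v ≤ N → ∀ f : ArithmeticFunction ℂ, f.IsMultiplicative → (∀ n, ‖f n‖ ≤ 1) → (∀ (q : ℕ) (χ : DirichletCharacter ℂ q) (τ : ℝ), 1 ≤ q → (q : ℝ) ≤ A₀ → |τ| ≤ N → A₀ ≤ Literature.NumberTheory.Sieve.pretentiousDistSq (⇑f) (Literature.NumberTheory.Sieve.twistedChar χ τ)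 N) → ‖∑ n ∈ (Finset.Icc u v).filter (fun n : ℤ => 0 < (Ψ (Fin.last t)).eval (fun _ => n)), (((∏ i : Fin t, Literature.NumberTheory.Sieve.intVonMangoldt ((Ψ (Fin.castSucc i)).eval (fun _ => n))) : ℝ) : ℂ) * f ((Ψ (Fin.last t)).eval (fun _ => n)).toNat‖ ≤ η * ((N : ℝ) + ∑ n ∈ Finset.Icc u v, ∏ i : Fin t, Literature.NumberTheory.Sieve.intVonMangoldt ((Ψ (Fin.castSucc i)).eval (fun _ => n)))

/-- item stmt-Parity-14833 · crux · rank 4 · closed · moot by None · by planner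
why it might fail: t=1 is EH; t≥2 is square-root-heuristic equidistribution of prime tuples to moduli N^(1−δ), known only at level 1/2 on average over shifts (Mikawa); Maier/Friedlander–Granville irregularities kill level N(log N)^(−B) — we stay at N^(1−δ); a sup over ALL residues r (not only admissible) is included.
sources: ElliottHalberstam1970, doi:10.21099/tkbjm/1496161970, FriedlanderGranville1989, BombieriFriedlanderIwaniecActa1986, Polymath8b2014, Maynard2015SmallGaps
[crux] RELATIVE TUPLE ELLIOTT–HALBERSTAM (distribution half; no main term, hence it asserts nothing
about existence): for t ≥ 1, L, δ > 0 and every B there is C with, for all N ≥ 2, every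
non-degenerate system Ψ of t forms on ℤ with ‖Ψ‖_N ≤ L, and every choice of intervals [u_d, v_d] ⊆
[−N, N] and residues r_d: Σ_(d ≤ N^(1−δ)) |Σ_(n∈[u_d,v_d], n≡r_d (d)) Π_iΛ(ψ_i(n)) − w_Ψ(d,
r_d)·Σ_(n∈[u_d,v_d]) Π_iΛ(ψ_i(n))| ≤ C N (log N)^(−B), where w_Ψ(d, r) = 1/#(admissible classes mod
d) if r is admissible (gcd(ψ_i(r), d) = 1 for all i) and 0 otherwise. t = 1 is the (relative,
interval) Elliott–Halberstam conjecture; t ≥ 2 says prime t-tuples are equidistributed among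
admissible classes to level N^(1−δ) (the restricted system's β_p is class-independent, so this is
the right model). [difficulty: open-problem] -/
@[route_item "route-Parity-InverseSieveTuples"]
def TupleLevelOne : Prop :=
  ∀ (t L : ℕ), 1 ≤ t → ∀ δ B : ℝ, 0 < δ → ∃ C : ℝ, ∀ N : ℕ, 2 ≤ N → ∀ Ψ : Fin t → Literature.NumberTheory.Sieve.AffLinForm 1, Literature.NumberTheory.Sieve.IsNondegenerateSystem Ψ → Literature.NumberTheory.Sieve.affLinSize Ψ N ≤ L → ∀ (u v r : ℕ → ℤ), (∀ d, -(N : ℤ) ≤ u d) → (∀ d, v d ≤ N) → ∑ d ∈ Finset.Icc 1 ⌊(N : ℝ) ^ (1 - δ)⌋₊, |(∑ n ∈ (Finset.Icc (u d) (v d)).filter (fun n : ℤ => n ≡ r d [ZMOD (d : ℤ)]), ∏ i, Literature.NumberTheory.Sieve.intVonMangoldt ((Ψ i).eval (fun _ => n))) - (if ∀ i, Int.gcd ((Ψ i).eval (fun _ => r d)) (d : ℤ) = 1 then (((Finset.Ico (0 : ℤ) (d : ℤ)).filter (fun ρ : ℤ => ∀ i, Int.gcd ((Ψ i).eval (fun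 _ => ρ)) (d : ℤ) = 1)).card : ℝ)⁻¹ else 0) * (∑ n ∈ Finset.Icc (u d) (v d), ∏ i, Literature.NumberTheory.Sieve.intVonMangoldt ((Ψ i).eval (fun _ => n)))| ≤ C * (N : ℝ) / Real.log N ^ B

/-- item stmt-Parity-0822 · support · rank 9 · closed · proved by Summit.Parity.GeneralizedHardyLittlewood.Theorems.leeYangFibres_fibrationLemma (prover) · by planner
sources: GreenTao2010, Gallagher1976
[assembly] The fibration lemma DimOne → GeneralizedHardyLittlewood [GreenTao2010, p. 6: 'holding d −
1 of the variables fixed and summing in the remaining one']. PROVABLE but sizable: (i) unimodular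
change of basis of ℤ^d making every linear part non-vanishing on e₁ (affLinSize and realBox change
by C(d,t,L): rescale N); (ii) fibres K_w = K ∩ (w + ℝe₁) are intervals ⊆ [-CN, CN], fibre systems
are d = 1 systems with constants ≤ C L N, non-degenerate off O_t(N^{d−2}) fibres (trivial bound N
log^t N on those); (iii) DimOne on each good fibre with N₀ uniform in w; (iv) main terms ∑_w |K_w ∩
{Ψ_w > 0}|·∏_p β_p(Ψ_w) = β_∞ ∏_p β_p + o(N^d) via FibreSingularProduct-type averaging weighted by
fibre lengths [GreenTao2010, App. A]. -/
@[route_item "route-Parity-InverseSieveTuples"]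
def FibrationLemma : Prop :=
  DimOne → GeneralizedHardyLittlewood

/-- `FibrationLemma` holds: proved by `Summit.Parity.GeneralizedHardyLittlewood.Theorems.leeYangFibres_fibrationLemma`. -/
theorem FibrationLemma_holds : FibrationLemma := _root_.Summit.Parity.GeneralizedHardyLittlewood.Theorems.leeYangFibres_fibrationLemma

/-- item stmt-Parity-14834 · support · rank 9 · closed · moot by None · by planner
sources: Shiu1980, HalberstamRichert1974, Friedlander1989BrunTitchmarsh, GreenTao2010
[support] upper-bound sieve for prime t-tuples on intervals (Selberg Λ²/Brun–Titchmarsh shape,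
uniform in the system): for t, L, δ > 0 there are C, N₀ with Σ_(u≤n≤v) Π_iΛ(ψ_i(n)) ≤ C(1 + 𝔖(Ψ))(v
− u) + N^δ for all N ≥ N₀, non-degenerate Ψ of t forms with ‖Ψ‖_N ≤ L and [u, v] ⊆ [−N, N]; the
factor 1 + 𝔖(Ψ) is necessary (primorial shifts). Provable from the tree's Selberg-sieve framework
(SieveFrameworkProofs, Shiu1980BrunTitchmarsh_holds pattern). [difficulty: L] -/
@[route_item "route-Parity-InverseSieveTuples"]
def TupleBrunTitchmarsh : Prop :=
  ∀ (t L : ℕ), 1 ≤ t → ∀ δ : ℝ, 0 < δ → ∃ C : ℝ, ∃ N₀ : ℕ, ∀ N : ℕ, N₀ ≤ N → ∀ Ψ : Fin t → Literature.NumberTheory.Sieve.AffLinForm 1, Literature.NumberTheory.Sieve.IsNondegenerateSystem Ψ → Literature.NumberTheory.Sieve.affLinSize Ψ N ≤ L → ∀ u v : ℤ, -(N : ℤ) ≤ u → u ≤ v → v ≤ N → (∑ n ∈ Finset.Icc u v, ∏ i, Literature.NumberTheory.Sieve.intVonMangoldt ((Ψ i).eval (fun _ => n))) ≤ C * (1 +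 Literature.NumberTheory.Sieve.singularProduct Ψ) * ((v : ℝ) - u) + (N : ℝ) ^ δ

/-- item stmt-Parity-14835 · support · rank 9 · closed · moot by None · by planner
sources: BombieriAsymptoticSieve1976, FriedlanderIwaniecPisa1978, Friedlander2006ProducingPrimes, GreenTao2010, Gallagher1976
[support] THE INDUCTIVE STEP (provable bookkeeping, the vector form of Bombieri's sieve): IST → HLE
→ TEH → TupleBrunTitchmarsh → for every t ≥ 1, DimOneRel_t → DimOneRel_(t+1), where DimOneRel_t is
DimOne at t with error ε(1 + 𝔖(Ψ))N. Proof plan: given a (t+1)-system Ψ and convex K, sift the last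
form: c_m = Σ_(n∈K⁺, ψ_t(n)=m) Π_(i<t)Λ(ψ_i(n)) on m ≤ x ≍ N (K⁺ = K ∩ (ψ_t > 0)); cases |K⁺| ≤ νN
(TupleBrunTitchmarsh) and 𝔖(Ψ_<t) = 0 or g(p) = 1 (local obstruction, O(log^C N)) are direct;
otherwise C(x) ≥ cνN, the density g(d) = Σ_(roots ρ of ψ_t mod d) w_(Ψ_<t)(d, ρ) is multiplicative
(CRT) and in the class with M = (2t+L+2)², Type-I for c relative to C(x) follows from TEH_t (≤ L
classes per modulus) plus the induction hypothesis on sub-intervals, mass/crude bounds are trivial,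
Axiom (M) for c at (A₀+1, x) is HLE at (A₀, N) (𝔻(·;N)² ≥ 𝔻(·;x)² − 1, |τ| ≤ N ≤ x²), IST gives Σ_m
Λ(m)c_m = H_g(x)C(x)(1 ± ε'), and β_p(Ψ) = β_p(Ψ_<t)·(p/(p−1))(1 − g(p)), archFactor Ψ K =
archFactor Ψ_<t K⁺, GT Lemma 1.3 (tree: tendsto_singularProductPartial_holds) turn H_g(x)·β_∞𝔖(Ψ_<t)
into β_∞𝔖(Ψ) + o((1+𝔖(Ψ))N); the IH error ε_t(1+𝔖_<t)N times H_g ≤ 𝔖(Ψ)/c_t stays relative.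
[difficulty: XL] -/
@[route_item "route-Parity-InverseSieveTuples"]
def SieveStep : Prop :=
  InverseSieveUniform → TupleElliott → TupleLevelOne → TupleBrunTitchmarsh → ∀ t : ℕ, 1 ≤ t → (∀ (L : ℕ) (ε : ℝ), 0 < ε → ∃ N₀ : ℕ, ∀ N : ℕ, N₀ ≤ N → ∀ Ψ : Fin t → Literature.NumberTheory.Sieve.AffLinForm 1, Literature.NumberTheory.Sieve.IsNondegenerateSystem Ψ → Literature.NumberTheory.Sieve.affLinSize Ψ N ≤ L → ∀ K : Set (Fin 1 → ℝ), Convex ℝ K → K ⊆ Literature.NumberTheory.Sieve.realBox 1 N → |Literature.NumberTheory.Sieve.vonMangoldtSum Ψ K N - Literature.NumberTheory.Sieve.archFactor Ψ K * Literature.NumberTheory.Sieve.singularProduct Ψ| ≤ ε * (1 + Literature.NumberTheory.Sieve.singularProduct Ψ) * (N : ℝ)) → (∀ (L : ℕ) (ε : ℝ), 0 < ε → ∃ N₀ : ℕ, ∀ N : ℕ, N₀ ≤ N → ∀ Ψ : Fin (t + 1) → Literature.NumberTheory.Sieve.AffLinForm 1, Literature.NumberTheory.Sieve.IsNondegenerateSystem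 Ψ → Literature.NumberTheory.Sieve.affLinSize Ψ N ≤ L → ∀ K : Set (Fin 1 → ℝ), Convex ℝ K → K ⊆ Literature.NumberTheory.Sieve.realBox 1 N → |Literature.NumberTheory.Sieve.vonMangoldtSum Ψ K N - Literature.NumberTheory.Sieve.archFactor Ψ K * Literature.NumberTheory.Sieve.singularProduct Ψ| ≤ ε * (1 + Literature.NumberTheory.Sieve.singularProduct Ψ) * (N : ℝ))

/-- item stmt-Parity-14836 · support · rank 9 · closed · moot by None · by planner
sources: Walfisz1936, GreenTao2010, HardyLittlewood1923
[support] the base t = 1 of the induction (= DimOne at t = 1, relative form): Σ_(n∈K) Λ(an + b) = |K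
∩ (an+b > 0)|·(|a|/φ(|a|))·1[(a,b)=1] + o(N) uniformly for |a| ≤ L, |b| ≤ LN, intervals K ⊆ [−N, N]
— PNT in progressions to the fixed moduli ≤ L over intervals of length ≤ 2LN (tree, proved:
Literature.NumberTheory.Sieve.siegel_walfisz via siegel_walfisz_holds), plus the evaluation of
singularProduct/archFactor for one form. [difficulty: M] -/
@[route_item "route-Parity-InverseSieveTuples"]
def DimOneRelBase : Prop :=
  ∀ (L : ℕ) (ε : ℝ), 0 < ε → ∃ N₀ : ℕ, ∀ N : ℕ, N₀ ≤ N → ∀ Ψ : Fin 1 → Literature.NumberTheory.Sieve.AffLinForm 1, Literature.NumberTheory.Sieve.IsNondegenerateSystem Ψ → Literature.NumberTheory.Sieve.affLinSize Ψ N ≤ L → ∀ K : Set (Fin 1 → ℝ), Convex ℝ K → K ⊆ Literature.NumberTheory.Sieve.realBox 1 N → |Literature.NumberTheory.Sieve.vonMangoldtSum Ψ K N - Literature.NumberTheory.Sieve.archFactor Ψ K * Literature.NumberTheory.Sieve.singularProduct Ψ| ≤ ε * (1 + Literature.NumberTheory.Sieve.singularProduct Ψ) * (N : ℝ)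

/-- item stmt-Parity-14837 · support · rank 9 · closed · moot by None · by planner
sources: GreenTao2010, MatomakiMerikoski2023, LichtmanTeravainen2022, Gallagher1976, MatomakiRadziwillTao2015
[support] RESIDUAL (declared; GHL-hard but thin): Dickson in d = 1 with error ε(1 + 𝔖(Ψ))N for every
t implies DimOne (error εN). Content = uniformity over systems whose singular series exceeds every
bound (shifts with many small prime factors, 𝔖 ≍ (log log N)^O(t)); it is exactly what fixed-η
structure + randomness cannot give, because the step t → t+1 multiplies errors by H = 𝔖(Ψ)/𝔖(Ψ_<t).
Discharge routes (not filed): rate versions — IST with error C(η^c + e^(−cA₀) + δ^c + (log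
x)^(−c))·H_g·A for A₀ ≤ c log log x, HLE with the Lichtman–Teräväinen exponential rate e^(−cM(f))
(their Thm 1.6 shape), TEH at level N·exp(−(log N)^(1/2)) — give DimOne with a log-power saving
directly. [difficulty: open-problem] -/
@[route_item "route-Parity-InverseSieveTuples"]
def RelToAbs : Prop :=
  (∀ t : ℕ, 1 ≤ t → ∀ (L : ℕ) (ε : ℝ), 0 < ε → ∃ N₀ : ℕ, ∀ N : ℕ, N₀ ≤ N → ∀ Ψ : Fin t → Literature.NumberTheory.Sieve.AffLinForm 1, Literature.NumberTheory.Sieve.IsNondegenerateSystem Ψ → Literature.NumberTheory.Sieve.affLinSize Ψ N ≤ L → ∀ K : Set (Fin 1 → ℝ), Convex ℝ K → K ⊆ Literature.NumberTheory.Sieve.realBox 1 N → |Literature.NumberTheory.Sieve.vonMangoldtSum Ψ K N - Literature.NumberTheory.Sieve.archFactor Ψ K * Literature.NumberTheory.Sieve.singularProduct Ψ| ≤ ε * (1 + Literature.NumberTheory.Sieve.singularProduct Ψ) * (N : ℝ)) → DimOne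

/-- item stmt-Parity-14838 · assembly · rank 1 · closed · moot by None · by planner
sources: BombieriAsymptoticSieve1976, GreenTao2010, LichtmanTeravainen2022
[assembly] InverseSieveUniform → TupleElliott → TupleLevelOne → TupleBrunTitchmarsh → SieveStep →
DimOneRelBase → RelToAbs → FibrationLemma → GeneralizedHardyLittlewood (the type of `closes`). -/
@[route_item "route-Parity-InverseSieveTuples"]
def Assembly : Prop :=
  InverseSieveUniform → TupleElliott → TupleLevelOne → TupleBrunTitchmarsh → SieveStep → DimOneRelBase → RelToAbs → FibrationLemma → GeneralizedHardyLittlewood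

end Summit.Parity.GeneralizedHardyLittlewood.Theses.InverseSieveTuples
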